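import Summits.BirchSwinnertonDyer.Rank1Residual.X11b.Three.KolyvaginClassBadPlace
import HarnessLib

/-!
# Gross 1991 Prop. 6.2 (1) at a TAMAGAWA-FREE bad place, WITHOUT the `E⁰`-receptacle: Kolyvagin's class is Selmer at a
# finite place `v` whenever the unramified part of `H¹(K_v, E)` is killed by an integer `c` coprime to the level `n`
# (cell `bsd-stepL`, seat `bsd-stepL-tam3-p1` g15, LINE OWNER of crux 19109 `EulerHalvesAtThree`;
# `--supports stmt-BirchSwinnertonDyer-19109 --as helper`)

WHY. On the carrier-inert Shimura road of crux 19109 (`Cruxes/EulerHalvesAtThree/Lines/inert.lean` r10) and of crux 21420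
(`Cruxes/CornerAtThreeW/Lines/inert.lean` r9) the ONE beyond-print input is the identity-component label (B6)
(`Literature.…ShimuraCMFamily.LabelB6`) of the CM family of `X_{N⁺,N⁻}`, consumed at EVERY bad place over a prime `q ∉ S`
by the Gross 6.2 (1) Kummer-membership producer (`ShimuraWalk.kolyvaginClass_familyData_mem_selmerLocalKer`, p600152, through
x11b3's `E⁰(K̄_v)`-receptacle END `GrossBadPlace.kolyvaginClass_kolyvaginPoint_mem_selmerLocalKer_of_GZ31_E0`). At a place `v`
whose local Tamagawa number `c_v` is prime to `p` the receptacle is NOT needed: the image `d_v` of Kolyvagin's class in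
`H¹(K_v, E)` is represented by the cocycle `σ ↦ −((σ−1)P/n)_v`, which VANISHES on the inertia group (`K[m]/K` is unramified at
`v ∤ m`), so it is an unramified class; `n • d_v = 0` (McCallum Lemma 4.1) and `c_v • d_v = 0` (Milne *ADT* I Prop. 3.8:
`H¹(G/I, E(K_v^un)) = H¹(G/I, π₀(𝒜₀))`, a group of order `#Φ_v(k_v) = c_v`), hence `d_v = 0` when `gcd(n, c_v) = 1`. This
file records that mechanism — Gross's coprimality trick `cls_mem_resKer_of_vanishing_of_zsmul_mem` (x11b3-p1) with the rôles
«`n′ • (values) ∈ B` + `B`-valued unramified classes vanish» replaced by «unramified classes are killed by `n′`» — so that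
the hSel producer can be re-run with (B6) asked ONLY at the places with `p ∣ c_v` (the carriers), the others being served by the
printed local fact (carried by its consumers as a displayed hypothesis; cite-only Literature def
`Milne2006_localTamagawaNumber_smul_unramifiedClass_eq_zero`, proposed separately).

RESULTS (namespace `Summit.BirchSwinnertonDyer.BirchSwinnertonDyer.Theorems.TamagawaFreePlace`):
* `cls_mem_resKer_of_vanishing_smul` — abstract compatible pair `(θ, Ψ)`: if `θ(I)` fixes `P` and every `M′`-valued continuous
  cocycle of `H` vanishing on `I` has class killed by `n′` with `n′` coprime to `n`, then `c(P)` lies in the local kernel.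
* `kolyvaginClass_mem_selmerLocalKer_of_inertia_of_smul_unramifiedClass` — the curve form at a finite place `v` of a number
  field: inertia `I_𝔐` fixes `P`, unramified classes of `H¹(K_v, E)` are killed by `n′`, `gcd(n, n′) = 1` ⟹ `c(P) ∈ 𝓢_v`.
* `kolyvaginClass_mem_selmerLocalKer_of_inertia_of_localTamagawaNumber_smul` — the same with `n′ := c_v(E/K_v)` (the binder
  shape of the Milne fact) and `gcd(n, c_v) = 1`.
* `isCoprime_pow_natCast_of_not_dvd` — `gcd(p^M, c) = 1` from `p ∤ c` (bookkeeping for the consumers, `n = p^M`).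

HONEST FRAMING. Helper lemmas (pure Galois-cohomology bookkeeping over the tree's Kolyvagin-class API); CONDITIONAL on the
displayed unramified-torsion hypothesis wherever used; nothing about any Heegner ∕ CM point is asserted; no stub is discharged; no
item closes; 0 classes move (T7); BSD is not proved by any of this. References: [cite: GrossLMS1991, §6 Prop. 6.2 (1) and proof
(pp. 244–245)] [cite: McCallumLMS1991, Lemma 4.1, Cor. 4.2, Lemma 4.3] [cite: MilneADT2006, Ch. I Prop. 3.8]
[cite: GreenbergLNM1716, §3 Lemma 3.3 and the remark after its proof]. Axioms: `propext`, `Classical.choice`, `Quot.sound`.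
-/

set_option autoImplicit false
set_option linter.dupNamespace false

noncomputable section

open scoped Classical
open scoped AddSubgroup

namespace Summit.BirchSwinnertonDyer.BirchSwinnertonDyer.Theorems.TamagawaFreePlace

open WeierstrassCurve NumberField IsDedekindDomain Field
  Literature.NumberTheory.EllipticCurves Literature.NumberTheory.EllipticCurves.KolyvaginCocycle
  Literature.NumberTheory.GaloisRepresentations
  Summit.BirchSwinnertonDyer.Rank1Residual.X11b.Three.GrossBadPlace

universe u

/-! ### §1 The mechanism for an abstract compatible pair -/

section Abstract

variable {G : Type u} [Group G] [TopologicalSpace G] [IsTopologicalGroup G]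
variable {M : Type u} [AddCommGroup M] [DistribMulAction G M] [TopologicalSpace M]
  [DiscreteTopology M]
variable {H : Type u} [Group H] [TopologicalSpace H] [IsTopologicalGroup H]
variable {M' : Type u} [AddCommGroup M'] [DistribMulAction H M'] [TopologicalSpace M']
  [DiscreteTopology M']
variable {A : AddSubgroup M} {n : ℤ}

/-- **Gross's mechanism with a torsion-killing constant** (Prop. 6.2 (1) at a Tamagawa-free place), for a compatible pair
`(θ : H → G, Ψ : M → M')`: suppose `θ(I)` fixes `P` for a set `I ⊆ H` (inertia; `K_n/K` is unramified at `v`) and every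
`M'`-valued continuous cocycle of `H` vanishing on `I` has class killed by an integer `n′` coprime to `n` ("`H¹(K_v^un/K_v, E)` has
order `c_v`", Milne I.3.8). Then `c(P; Q)` lies in the kernel of `H¹(G, M[n]) → H¹(H, M')`: its image is the class of
`h ↦ −Ψ((θh−1)P/n)` (`map_cls_eq_pullback_negRootCocycle`), which vanishes on `I`, so it is killed by `n′`, and by `n`
(`zsmul_cls_eq_zero`), hence it is zero. [cite: GrossLMS1991, Prop. 6.2 (1)] [cite: McCallumLMS1991, Lemma 4.1, Cor. 4.2]
[cite: MilneADT2006, Ch. I Prop. 3.8] -/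
theorem cls_mem_resKer_of_vanishing_smul (θ : H →ₜ* G) (Ψ : M →+ M')
    (hΨ : ∀ (h : H) (m : M), Ψ (θ h • m) = h • Ψ m)
    (hA : IsAdmissible G A n) (hcont : ∀ m : M, Continuous fun g : G ↦ g • m)
    {P : M} (hP : P ∈ invPoints G A n) {Q : M} (hQ : n • Q = P)
    (hc : ∀ (h : H) (x : M[n]),
      (Ψ.comp (M[n]).subtype) (θ h • x) = h • (Ψ.comp (M[n]).subtype) x)
    {I : Set H} (hI : ∀ σ ∈ I, θ σ • P = P)
    {n' : ℤ} (hcop : IsCoprime n n')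
    (hvanish : ∀ f : contOneCocycles (discreteTopRep H M'),
      (∀ σ ∈ I, f.1 σ = 0) → n' • oneCocycleClass _ f = 0) :
    cls hA hcont hP hQ ∈ resKer θ (Ψ.comp (M[n]).subtype) hc := by
  rw [mem_resKer_iff]
  set x := ContinuousCohomology.map θ (resHomOfEquivariant θ (Ψ.comp (M[n]).subtype) hc) 1
    (cls hA hcont hP hQ) with hx
  -- `n • x = 0`
  have hn : n • x = 0 := by
    rw [hx, ← map_zsmul, zsmul_cls_eq_zero hA hcont hP hQ, map_zero]
  -- `n' • x = 0`: the local cocycle vanishes on `I`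
  have hn' : n' • x = 0 := by
    rw [hx, map_cls_eq_pullback_negRootCocycle θ Ψ hΨ hA hcont hP hQ hc]
    refine hvanish _ (fun σ hσ ↦ ?_)
    rw [contOneCocycles.pullback_apply, negRootCocycle_apply, hI σ hσ, sub_self,
      rootIn_zero hA.eq_zero_of_zsmul, neg_zero]
    change Ψ 0 = 0
    exact map_zero Ψ
  obtain ⟨a, b, hab⟩ := hcop
  calc x = (a * n + b * n') • x := by rw [hab, one_zsmul]
    _ = 0 := by rw [add_zsmul, mul_zsmul, mul_zsmul, hn, hn', zsmul_zero, zsmul_zero, add_zero]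

end Abstract

/-! ### §2 The curve form at a finite place of a number field -/

section Curve

variable {K : Type u} [Field K] [NumberField K] (W : WeierstrassCurve K) {n : ℤ}
variable {hdiv : ∀ P : geomPoints W, ∃ Q : geomPoints W, n • Q = P}
variable {A : AddSubgroup (geomPoints W)}

/-- **Gross 1991 Prop. 6.2 (1) at a finite place whose unramified classes are `n′`-torsion, `gcd(n, n′) = 1`.** Let `E = W`
be an elliptic curve over a number field `K`, `c(P)` Kolyvagin's class of `P ∈ A` (`A ⊆ E(K̄)` admissible, level `n`), `v` a
finite place, `𝔐` a prime of the local absolute integers whose inertia group `I_𝔐 ≤ Γ_{K_v}` FIXES `P` (printed: `K_n/K` is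
unramified at `v ∤ n`). If every continuous crossed homomorphism `Γ_{K_v} → E(K̄_v)` vanishing on `I_𝔐` has class killed by
`n′` and `n′` is coprime to `n`, then `c(P) ∈ selmerLocalKer W K_v n` ("`d(n)_v = 0`"). With `n′ = 1` this is the tree's
good-reduction leaf; with `n′ = c_v` it is the Tamagawa-free bad-place leaf below.
[cite: GrossLMS1991, Prop. 6.2 (1), pp. 244–245] [cite: MilneADT2006, Ch. I Prop. 3.8] -/
theorem kolyvaginClass_mem_selmerLocalKer_of_inertia_of_smul_unramifiedClass
    (hA : IsAdmissible (absoluteGaloisGroup K) A n) {P : geomPoints W}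
    (hP : P ∈ invPoints (absoluteGaloisGroup K) A n)
    (v : HeightOneSpectrum (𝓞 K)) {𝔐 : Ideal (v.localAbsIntegers)}
    (hI : ∀ σ ∈ 𝔐.inertia (absoluteGaloisGroup (v.adicCompletion K)),
      resGal (K := K) (v.adicCompletion K) σ • P = P)
    {n' : ℤ} (hcop : IsCoprime n n')
    (hvanish : ∀ f : contOneCocycles (discreteTopRep (absoluteGaloisGroup (v.adicCompletion K))
        (localPoints W (v.adicCompletion K))),
      (∀ σ ∈ 𝔐.inertia (absoluteGaloisGroup (v.adicCompletion K)), f.1 σ = 0) →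
        n' • oneCocycleClass _ f = 0) :
    kolyvaginClass W n hdiv hA P hP ∈ selmerLocalKer W (v.adicCompletion K) n :=
  cls_mem_resKer_of_vanishing_smul (resGal (K := K) (v.adicCompletion K))
    (pointsMap W (v.adicCompletion K)) (pointsMap_smul W (v.adicCompletion K)) hA _ hP _ _ hI hcop
    hvanish

/-- **Gross 1991 Prop. 6.2 (1) at a TAMAGAWA-FREE place** (`gcd(n, c_v) = 1`, ANY reduction type, no `E⁰`-receptacle): if the
inertia group `I_𝔐` fixes `P` and every continuous crossed homomorphism `Γ_{K_v} → E(K̄_v)` vanishing on `I_𝔐` has class killed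
by the local Tamagawa number `c_v = c_v(E/K_v)` of the minimal model (Milne *ADT* I Prop. 3.8: `H¹(G/I, E(K_v^un)) =
H¹(G/I, π₀(𝒜₀))`, of order `#Φ_v(k_v) = c_v` — the displayed hypothesis `hM38`, the body of the cite-only Literature fact
`Milne2006_localTamagawaNumber_smul_unramifiedClass_eq_zero` at `(W, v, 𝔐)`), then `c(P) ∈ selmerLocalKer W K_v n`.
[cite: GrossLMS1991, Prop. 6.2 (1), pp. 244–245] [cite: MilneADT2006, Ch. I Prop. 3.8]
[cite: GreenbergLNM1716, §3, remark after the proof of Lemma 3.3] -/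
theorem kolyvaginClass_mem_selmerLocalKer_of_inertia_of_localTamagawaNumber_smul [W.IsElliptic]
    (hA : IsAdmissible (absoluteGaloisGroup K) A n) {P : geomPoints W}
    (hP : P ∈ invPoints (absoluteGaloisGroup K) A n)
    (v : HeightOneSpectrum (𝓞 K)) {𝔐 : Ideal (v.localAbsIntegers)}
    (hI : ∀ σ ∈ 𝔐.inertia (absoluteGaloisGroup (v.adicCompletion K)),
      resGal (K := K) (v.adicCompletion K) σ • P = P)
    (hcop : IsCoprime n
      ((W.baseChange (v.adicCompletion K)).localTamagawaNumber (v.adicCompletionIntegers K) : ℤ))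
    (hM38 : ∀ f : contOneCocycles (discreteTopRep (absoluteGaloisGroup (v.adicCompletion K))
        (localPoints W (v.adicCompletion K))),
      (∀ σ ∈ 𝔐.inertia (absoluteGaloisGroup (v.adicCompletion K)), f.1 σ = 0) →
        ((W.baseChange (v.adicCompletion K)).localTamagawaNumber (v.adicCompletionIntegers K) : ℤ) •
          oneCocycleClass _ f = 0) :
    kolyvaginClass W n hdiv hA P hP ∈ selmerLocalKer W (v.adicCompletion K) n :=
  kolyvaginClass_mem_selmerLocalKer_of_inertia_of_smul_unramifiedClass W hA hP v hI hcop hM38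

end Curve

/-! ### §3 Bookkeeping: `gcd(p^M, c) = 1` from `p ∤ c` -/

/-- `p^M` is coprime to every natural number not divisible by the prime `p`. [folklore] -/
theorem isCoprime_pow_natCast_of_not_dvd {p : ℕ} (hp : p.Prime) (M : ℕ) {c : ℕ} (hc : ¬ p ∣ c) :
    IsCoprime (((p ^ M : ℕ) : ℤ)) (c : ℤ) := by
  rw [Nat.cast_pow]
  exact (Nat.isCoprime_iff_coprime.mpr ((hp.coprime_iff_not_dvd).mpr hc)).pow_left

end Summit.BirchSwinnertonDyer.BirchSwinnertonDyer.Theorems.TamagawaFreePlace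

end
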